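import Literature.AnabelianGeometry.AbsoluteAnabelian.AbsAnabUnitsTransportLevelwise
import Literature.AnabelianGeometry.AbsoluteAnabelian.AbsAnabLevelReciprocityProofs
import Literature.AnabelianGeometry.AbsoluteAnabelian.MLFReciprocityCharacterizedProofs
import Literature.AnabelianGeometry.AbsoluteAnabelian.GaloisCyclotomeFunctoriality
import HarnessLib

/-!
# [AbsAnab] Prop. 1.2.1 (iii)/(vi) at the bottom level, pointwise: THE units transport intertwines THE
# canonical reciprocity maps through `α^{ab}`

S. Mochizuki, *The Absolute Anabelian Geometry of Hyperbolic Curves* (2004) [AbsAnab], Prop. 1.2.1 (iii) p. 10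
(«`α^{ab}` preserves the images `Im(K^×_i)`») and its proof p. 11 («the morphism induced by `α`»; (vi) «the
morphisms induced by `α` on the abelianizations of the various open subgroups»).  PROOF-ONLY brick (abc-iut
layer L4, row «Cor110ii-PRIME», abc-iut-L4-d1) for the NATURALITY of [AbsTopIII] Cor. 1.10 (i)(b)
(`AbsTopIII.cor_1_10_i_b_natural_holds`): for `α : G_{K₁} ≃ₜ* G_{K₂}` and ANY `α`-equivariant
uniformiser-preserving `ψ̄ : K̄₁ˣ ⥲ K̄₂ˣ` (THE units transport of abc-iut-L4-d3 / abc-iut-L6-t13), `ψ̄` carries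
`K₁ˣ` into `K₂ˣ` and `θ_{K₂} (ψ̄ a) = α^{ab} (θ_{K₁} a)` for THE canonical reciprocity maps `θ_{Kᵢ}` (Serre's
`θ` read in the Weil datum, `isReciprocitySystemE` at the bottom level `E = K`) — the level clause of
`Prop121vii.levelwise_of_isAlphaEquivariant` at `E = K`, read back on `G_K^{ab}` through
`levelArt_eq_mk_iff_theta` and the observation that `absGaloisRestrict K K`, `liftGal K K` are INNER, hence
trivial on the abelianization.  Theorems only.  HONEST FRAMING: classical local class field theory; nothing
here bears on [IUTchIII] Cor. 3.12.
-/

noncomputable section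

open Field IsNonarchimedeanLocalField ValuativeRel
open scoped Pointwise

namespace Literature.AnabelianGeometry.AbsoluteAnabelian

open Literature.NumberTheory.GaloisRepresentations
open Literature.NumberTheory.GaloisRepresentations.IsNonarchimedeanLocalField
open Literature.NumberTheory.GaloisRepresentations.LocalWeilDatum
open AbstractCFT AbstractCFT.WeilDatum

namespace Cor110iiPrime

/-! ### The bottom level `E = K`: `liftGal`, `absGaloisRestrict` are inner, hence trivial on `G_K^{ab}` -/

section Self

variable (K : Type) [Field K]

/-- For `E = K` the restriction `absGaloisRestrict K K : G_K → G_K` along the chosen embedding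
`ι : K̄ → K̄` is conjugation by `ι ∈ G_K`: `res σ = ι⁻¹ σ ι`. [folklore] -/
private theorem absGaloisRestrict_self_eq_conj :
    ∃ τ : absoluteGaloisGroup K, ∀ σ : absoluteGaloisGroup K, absGaloisRestrict K K σ = τ⁻¹ * σ * τ := by
  refine ⟨absClosureEquiv K K, fun σ => ?_⟩
  haveI : FaithfulSMul (absoluteGaloisGroup K) (AlgebraicClosure K) :=
    ⟨fun {a b} h => AlgEquiv.ext fun x => h x⟩
  refine eq_of_smul_eq_smul fun x : AlgebraicClosure K => ?_
  have h := absGaloisRestrict_apply_smul K K σ x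
  simp only [← absClosureEquiv_apply] at h
  rw [mul_smul, mul_smul, eq_inv_smul_iff]
  exact h

/-- On the abelianization, `[res σ] = [σ]` at the bottom level. [folklore] -/
private theorem absGaloisAbProj_absGaloisRestrict_self (σ : absoluteGaloisGroup K) :
    absGaloisAbProj K (absGaloisRestrict K K σ) = absGaloisAbProj K σ := by
  obtain ⟨τ, hτ⟩ := absGaloisRestrict_self_eq_conj K
  rw [hτ, map_mul, map_mul, mul_right_comm, ← map_mul, inv_mul_cancel, map_one, one_mul]

/-- On the abelianization, `[liftGal γ] = [γ]` at the bottom level. [folklore] -/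
private theorem absGaloisAbProj_liftGal_self {γ : absoluteGaloisGroup K} (hγ : γ ∈ galFixing K (embField K K)) :
    absGaloisAbProj K (liftGal K K hγ) = absGaloisAbProj K γ := by
  conv_rhs => rw [← absGaloisRestrict_liftGal K K hγ]
  rw [absGaloisAbProj_absGaloisRestrict_self]

end Self

/-! ### The canonical reciprocity map transported by THE units transport -/

section Base

variable {K₁ K₂ : Type} [Field K₁] [ValuativeRel K₁] [TopologicalSpace K₁]
  [IsNonarchimedeanLocalField K₁] [CharZero K₁] [Field K₂] [ValuativeRel K₂] [TopologicalSpace K₂]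
  [IsNonarchimedeanLocalField K₂] [CharZero K₂] [ValuativeExtension K₁ K₁] [ValuativeExtension K₂ K₂]

/-- **[AbsAnab] Prop. 1.2.1 (iii)/(vi) at the bottom level, POINTWISE**: for an isomorphism of profinite
groups `α : G_{K₁} ≅ G_{K₂}` and any `α`-equivariant uniformiser-preserving `ψ̄ : K̄₁ˣ ⥲ K̄₂ˣ` (THE units
transport), `ψ̄` carries `K₁ˣ` into `K₂ˣ` and intertwines THE canonical reciprocity maps `θ_{Kᵢ}` (Serre's
`θ` read in the Weil datum, `isReciprocitySystemE`) through `α^{ab}`: `θ_{K₂} (ψ̄ a) = α^{ab} (θ_{K₁} a)`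
(«THE morphism induced by `α`», [AbsAnab] proof of Prop. 1.2.1 p. 11; the level clause of
`Prop121vii.levelwise_of_isAlphaEquivariant` at `E = K`). [cite: MochizukiAbsAnab2004, Prop 1.2.1 (iii) p.11] -/
theorem exists_theta_unitsTransport (α : absoluteGaloisGroup K₁ ≃ₜ* absoluteGaloisGroup K₂)
    {ψ : (AlgebraicClosure K₁)ˣ ≃* (AlgebraicClosure K₂)ˣ} (hψ : Prop121vii.IsAlphaEquivariant α ψ)
    (hU : Prop121vii.PreservesUniformizers ψ) (a : K₁ˣ) :
    ∃ b : K₂ˣ,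
      ψ (Units.map (algebraMap K₁ (AlgebraicClosure K₁) : K₁ →* AlgebraicClosure K₁) a) =
        Units.map (algebraMap K₂ (AlgebraicClosure K₂) : K₂ →* AlgebraicClosure K₂) b ∧
      (isReciprocitySystemE (F := K₂) (E := K₂) (isClassFieldTheory_localWeilDatum K₂)).theta b =
        abelianizationCongr α
          ((isReciprocitySystemE (F := K₁) (E := K₁) (isClassFieldTheory_localWeilDatum K₁)).theta a) := by
  classical
  -- the characterised reciprocity maps of the bottom levels
  obtain ⟨Art₁, -, -, -, hchar₁, -⟩ := exists_reciprocity_characterized_embField K₁ K₁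
  obtain ⟨Art₂, -, -, -, hchar₂, -⟩ := exists_reciprocity_characterized_embField K₂ K₂
  have hN : ∀ g : absoluteGaloisGroup K₁,
      g ∈ galFixing K₁ (embField K₁ K₁) ↔ α g ∈ galFixing K₂ (embField K₂ K₂) := fun g =>
    ⟨fun _ => mem_galFixing_embField_self _, fun _ => mem_galFixing_embField_self _⟩
  -- `a` at the bottom level
  let u : (embField K₁ K₁)ˣ := Units.map (equivEmbField K₁ K₁ : K₁ →* embField K₁ K₁) a
  have hu : Units.map ((equivEmbField K₁ K₁).symm : embField K₁ K₁ →* K₁) u = a := by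
    apply Units.ext
    change (equivEmbField K₁ K₁).symm (equivEmbField K₁ K₁ (a : K₁)) = a
    exact (equivEmbField K₁ K₁).symm_apply_apply _
  let x : (AlgebraicClosure K₁)ˣ :=
    Units.map (algebraMap K₁ (AlgebraicClosure K₁) : K₁ →* AlgebraicClosure K₁) a
  have hxu : (x : AlgebraicClosure K₁) = ((u : embField K₁ K₁) : AlgebraicClosure K₁) := by
    rw [coe_embField_self]
    change algebraMap K₁ (AlgebraicClosure K₁) (a : K₁) =
      algebraMap K₁ (AlgebraicClosure K₁) ((equivEmbField K₁ K₁).symm (equivEmbField K₁ K₁ (a : K₁)))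
    rw [(equivEmbField K₁ K₁).symm_apply_apply]
  -- the level clause of THE units transport at `E = K`
  obtain ⟨v, hv, -, -, hArt⟩ := Prop121vii.levelwise_of_isAlphaEquivariant α hψ hU K₁ K₂ hN u x hxu
  set θ₁ := (isReciprocitySystemE (F := K₁) (E := K₁) (isClassFieldTheory_localWeilDatum K₁)).theta with hθ₁
  set θ₂ := (isReciprocitySystemE (F := K₂) (E := K₂) (isClassFieldTheory_localWeilDatum K₂)).theta with hθ₂
  let b : K₂ˣ := Units.map ((equivEmbField K₂ K₂).symm : embField K₂ K₂ →* K₂) v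
  refine ⟨b, Units.ext ?_, ?_⟩
  · change (ψ x : AlgebraicClosure K₂) = algebraMap K₂ (AlgebraicClosure K₂) ((equivEmbField K₂ K₂).symm v)
    rw [hv, coe_embField_self]
  · -- `Art₁ u = [h]` with `liftGal h = σ₁`, `[σ₁] = θ₁ a`
    obtain ⟨σ₁, hσ₁⟩ := QuotientGroup.mk_surjective (θ₁ a)
    let h : galFixing K₁ (embField K₁ K₁) :=
      ⟨absGaloisRestrict K₁ K₁ σ₁, mem_galFixing_embField_self _⟩
    have hlift : liftGal K₁ K₁ h.2 = σ₁ := liftGal_absGaloisRestrict K₁ K₁ σ₁ h.2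
    have h₁ : Art₁ u = QuotientGroup.mk h := by
      rw [levelArt_eq_mk_iff_theta hchar₁, hlift, hu]
      exact hσ₁
    have h₂ := hArt hchar₁ hchar₂ h h₁
    rw [levelArt_eq_mk_iff_theta hchar₂] at h₂
    -- `θ₂ b = [liftGal (α h)] = [α h] = [α (res σ₁)] = α^{ab} [res σ₁] = α^{ab} [σ₁]`
    change θ₂ b = _
    rw [← h₂, absGaloisAbProj_liftGal_self]
    change absGaloisAbProj K₂ (α (absGaloisRestrict K₁ K₁ σ₁)) = _
    rw [← hσ₁]
    change _ = abelianizationCongr α (absGaloisAbProj K₁ σ₁)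
    rw [← absGaloisAbProj_absGaloisRestrict_self K₁ σ₁]
    change absGaloisAbProj K₂ (α (absGaloisRestrict K₁ K₁ σ₁)) =
      abelianizationCongr α (QuotientGroup.mk (absGaloisRestrict K₁ K₁ σ₁))
    rw [abelianizationCongr_mk]
    rfl

end Base

end Cor110iiPrime

end Literature.AnabelianGeometry.AbsoluteAnabelian
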